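import Literature.MathematicalPhysics.QuantumFieldTheory.Balaban1983to89.B9Eq357Levels
import Literature.MathematicalPhysics.QuantumFieldTheory.Balaban1983to89.B7Eq162General

/-!
# `Balaban1983to89.B9Eq358KeyEstimate` — T. Bałaban, *Propagators for lattice gauge theories in a background field*,
Commun. Math. Phys. **99** (1985) 389–434 [Balaban1985BackgroundPropagators]: the key estimate of p. 401 behind (3.58),
«|(U′U)(Γ^{(j)}_{y,x})(U(Γ^{(j)}_{y,x}))⁻¹ − 1| < O(1)α₁», and (3.58)–(3.59), for ALL `j`, with the inputs (161)–(163) of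
[5] = [Balaban1985Averaging] now SUPPLIED at a general background

statement-level skeleton of published theorems with citation tags; proofs where landed; nothing here is a claim about the Yang–Mills mass gap

v1.1 (p06 gen 8, 2026-08-21): DOCFIX ONLY — citation page numerals: (3.58) is printed on p. 402 [PDF 14] ((3.57) and the key estimate on p. 401);
`[cite]` locators re-pointed (CITELOC row P31-170); declarations byte-identical.

PDF held: `paper:balaban1985-cmp99-background-propagators` (journal page = PDF page + 388; p. 401 [PDF 13], p. 402 [PDF 14],
renders `b2b-balaban-ref1/pages/1985-cmp99-background-propagators/…-p013-x2.png`, `…-p014-x2.png`, READ AS IMAGES).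

CITATION HEADER / WHAT IS REPRODUCED.  SKELETON row **B9.Eq3.58** ((3.57)–(3.59) pp. 401–402), third file of seat p06 on the row
(file 1 `B9Eq358Decomposition` p243775: objects, the decomposition `Q′_j(U′U) = Q′_j(U) + F′_{2,j}(A)` EXACT, (3.58)/(3.59) from the key
estimate; file 2 `B9Eq357Levels` p245713: (3.55)–(3.57) exact and the key estimate FROM the printed per-level inputs [5]
(161)–(163) as HYPOTHESES `hδ`, `hv` — HOME/GAPS.md G-B9-p06-1); cell `lit-balaban` (HOME `run/shared/lean/pub/lit-balaban/`), seat
p06 gen 2 = unit `lit-balaban-p06`.  p. 401, verbatim: *"Applying the inequalities (161), (162) [5], we have (1/i) log U̿′^l =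
Q_l(U, ξA′), |Q_l(U, ξA′)| < 2α₁L^lξ, |(1/i) log(\overline{R̄^l_{x_{l+1}}U̿′^l})| < O(1)α₁L^{l+1}ξ, |v_j(y) − 1| < O(1)α₁ for α₁
sufficiently small. By Proposition 4 [5] the expression on the right-hand side of (3.57) is an analytic function of A, and by the
above bounds |(U′U)(Γ^{(j)}_{y,x})(U(Γ^{(j)}_{y,x}))⁻¹ − 1| < O(1)α₁."*  p. 402: *"where F′_{2,j}(A) is a matrix valued function
on the space of functions defined on T, and its kernel satisfies |F′_{2,j}(A; y, x)| ≤ O(1)α₁, (3.58) hence also |(F′_{2,j}(A)λ)(y)|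
≤ O(1)α₁(Q′_j|λ|)(y). (3.59)"*

THIS FILE CLOSES GAPS G-B9-p06-1: the binders `hδ` (per level: `|(\overline{R̄^lU̿′^l})⁻¹(R̄^lU̿′^l)(Γ_{x_{l+1},x_l}) − 1| ≤
cα₁L^{l+1}ξ`) and `hv` (`|v_j(y) − 1| ≤ c′α₁`) of `B9Eq357Levels.norm_pFac_sub_one_le_explicit` are INSTANTIATED from
[Balaban1985Averaging] (161)–(163) AT A GENERAL BACKGROUND (`B7Eq123General.prop4_general` = [5] Prop. 4 (131) with the (123)
remainder proved there; `B7Eq162General.norm_frameInv_mul_twist_general`, `.eq163_general`), with `c = 22d`, `c′ = 64d`.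
DICTIONARY (the lineage reads every level on the unit lattice of `B7Prop1Explicit.Site d = ℤᵈ`, `i`, `η` absorbed):
«U regular (3.35), Mα₀ small» ↦ `U` with values in an averaging-closed subgroup `G` (`B7Prop2Explicit.AvgClosed`) and plaquette
deviation `pdev U < α₀L^{−2j}` ([5] (52) at depth `j`), `C₀α₀ ≤ 1/3`, `4α₀ ≤ c₂′(d,L)`; «U′ = e^{iξA′}, A′ 𝔤ᶜ-valued, |A′| < α₁»
↦ `U′ = expCfg B` with `B` ANY `𝔸`-valued field (complex perturbations allowed), `sup|B_b| ≤ b` — `b` plays `α₁ξ`, so `Lʲb`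
plays `α₁`; «α₁ sufficiently small» ↦ the three displayed inequalities `e^{4cα₀}(1 + 8C₁Lʲb) ≤ 2`, `2Lʲb ≤ c₃(d,L)`,
`2048·d·Lʲb ≤ 1` (`c = 800(d+1)²(d+4)`, `C₁ = 131072(d+1)²` of [5] Props. 3–4).

WHAT THIS FILE PROVES (kernel, 0 sorry, theorems only).
* **`norm_pFac_sub_one_le_general`** — THE KEY ESTIMATE OF p. 401 FOR EVERY `j`, UNCONDITIONALLY: for `x ∈ B^j(y)`,
  `|P(y, x) − 1| = |(U′U)(Γ^{(j)}_{y,x})(U(Γ^{(j)}_{y,x}))⁻¹ − 1| ≤ (1 + 64d·Lʲb)e^{44d·Lʲb} − 1` — an `O(1)α₁` UNIFORM in `j`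
  (for complex `B` too); `norm_pFac_sub_one_le_linear`: `≤ 154d·Lʲb` under `4096·d·Lʲb ≤ 1`.
* **`norm_FpOp_le_general`** — (3.58)/(3.59) for every `j`: `|(F′_{2,j}(A)λ)(y)| ≤ 2((1 + 64dLʲb)e^{44dLʲb} − 1)(Q′_j|λ|)(y)`,
  given in addition that the averages of the PRODUCT `U′U` up to level `j` are unit-bounded (`B9Eq358Decomposition.norm_FpOp_le`
  compares the two rotations `R((U′U)(Γ))`, `R(U(Γ))`); **`norm_FpOp_le_unitary`** — that extra binder DISCHARGED for
  perturbations `U′U` that stay `G`-valued and regular at depth `j` ([5] Prop. 2, `B7Prop2Explicit.avgIter_mem`), i.e. for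
  `𝔤`-valued `A′` as in (3.37) with its derivative condition.
HONEST SCOPE: for COMPLEX `A′` the tower `\overline{U′U}^l` is not unit-bounded and (3.59) in file 1's form keeps that binder
(print obtains the complex case from the analyticity of (3.57), [5] Props. 4/6/7 — `B7Eq162General.eq164_general` is the
size bound (164), not used here); the KEY ESTIMATE itself is proved for complex `B`.
-/

noncomputable section

open scoped BigOperators
open NormedSpace Finset

namespace Literature.MathematicalPhysics.QuantumFieldTheory.Balaban1983to89.B9Eq358KeyEstimate

open B7Prop1Explicit B7Prop2Explicit B7Prop3Flat B7Eq92Concrete MatrixLog B7Prop4GeneralLevels B7Eq123General B7Eq162General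
  B9Eq358Decomposition B9Eq357Levels
open B8Ineq130 (fl)

-- `Site` alone would resolve to the torus sites of `Setup.lean`; re-export the `ℤ^d` sites of `B7Prop1Explicit`.
export B7Prop1Explicit (Site)

variable {d : ℕ}
variable {𝔸 : Type*} [NormedRing 𝔸] [NormedAlgebra ℂ 𝔸] [CompleteSpace 𝔸] [NormOneClass 𝔸]
variable {L : ℕ} {G : Subgroup 𝔸ˣ} {j : ℕ} {U : Site d → Fin d → 𝔸ˣ} {α₀ : ℝ} {B : Site d → Fin d → 𝔸} {b : ℝ}

/-! ## §1 The key estimate of p. 401, for every `j` -/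

/-- **THE KEY ESTIMATE OF p. 401, UNCONDITIONAL FOR EVERY `j`** — *"Applying the inequalities (161), (162) [5], we have …
|v_j(y) − 1| < O(1)α₁ for α₁ sufficiently small. … and by the above bounds |(U′U)(Γ^{(j)}_{y,x})(U(Γ^{(j)}_{y,x}))⁻¹ − 1| <
O(1)α₁."*  For `U` `G`-valued (`AvgClosed d L G`, `L ≥ 2`) with `pdev U < α₀L^{−2j}`, `C₀α₀ ≤ 1/3`, `4α₀ ≤ c₂′(d,L)`; `U′ =
e^{B}` with `sup|B_b| ≤ b` (`b` = `α₁ξ`); `e^{4cα₀}(1 + 8C₁Lʲb) ≤ 2`, `2Lʲb ≤ c₃(d,L)`, `2048·d·Lʲb ≤ 1`: for every `x ∈ B^j(y)`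
(`⌊·/L⌋^{[j]}x = y`), `|P(y,x) − 1| ≤ (1 + 64d·Lʲb)·e^{2·22d·Lʲb} − 1`.  Proof: `B9Eq357Levels.norm_pFac_sub_one_le_explicit`
(the telescoped (3.57)) with its per-level inputs `hδ` (`c = 22d`) = `B7Eq162General.norm_frameInv_mul_twist_general` ((161)–
(162) of [5] at a general background) and `hv` (`c′ = 64d`) = `B7Eq162General.eq163_general` ((163)).
[cite: Balaban1985BackgroundPropagators, (3.57) p.401, (3.58) p.402] -/
theorem norm_pFac_sub_one_le_general (hL : 2 ≤ L) (hG : AvgClosed d L G) (hU : ∀ x κ, U x κ ∈ G) (hα : 0 < α₀)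
    (hα3 : C0 d * α₀ ≤ 1 / 3) (hα4 : 4 * α₀ ≤ c2' d L) (h52 : pdev U < α₀ * (((L : ℝ) ^ j)⁻¹) ^ 2)
    (hb : 0 ≤ b) (hB : ∀ x κ, ‖B x κ‖ ≤ b)
    (hsmall : Real.exp (4 * (800 * ((d : ℝ) + 1) ^ 2 * ((d : ℝ) + 4)) * α₀)
      * (1 + 8 * (131072 * ((d : ℝ) + 1) ^ 2) * ((L : ℝ) ^ j * b)) ≤ 2)
    (hc₃ : 2 * ((L : ℝ) ^ j * b) ≤ c3 d L) (hsm : 2048 * (d : ℝ) * ((L : ℝ) ^ j * b) ≤ 1)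
    (y : Site d) {x : Site d} (hx : (fl L)^[j] x = y) :
    ‖((pFac L U (expCfg B) j y x : 𝔸ˣ) : 𝔸) - 1‖
      ≤ (1 + 64 * (d : ℝ) * ((L : ℝ) ^ j * b)) * Real.exp (2 * (22 * (d : ℝ)) * ((L : ℝ) ^ j * b)) - 1 := by
  have hL1 : 1 ≤ L := le_trans (by norm_num) hL
  have hLj : (0 : ℝ) < (L : ℝ) ^ j := by positivity
  -- the background tower is unit-bounded ([5] Prop. 2 at every level)
  have hUl : ∀ l ≤ j, ∀ z κ, avgIter L U l z κ ∈ U1 𝔸 := fun l hl =>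
    (level_facts hL hG hU hα hα3 hα4 h52 hb hB hsmall hc₃ l hl).1
  -- `hδ`: the level factors, (161)–(162) of [5] at a general background (`c = 22d`, `α₁ = Lʲb`)
  have hδ : ∀ l < j, ∀ x' : Site d,
      ‖((((frame L U (expCfg B) l ((L : ℤ) • fl L x'))⁻¹ * twist L U (expCfg B) l x' : 𝔸ˣ) : 𝔸)) - 1‖
        ≤ (22 * (d : ℝ)) * ((L : ℝ) ^ j * b) * ((L : ℝ) ^ (l + 1) / (L : ℝ) ^ j) := by
    intro l hl x'
    have h := norm_frameInv_mul_twist_general hL hG hU hα hα3 hα4 h52 hb hB hsmall hc₃ hsm hl ((L : ℤ) • fl L x')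
      (l1_sub_fl_le hL1 x')
    refine (le_of_eq (by rfl)).trans (h.trans (le_of_eq ?_))
    field_simp
  -- `hv`: (163) of [5] at a general background (`c′ = 64d`)
  have hv : ‖((vcov L U (expCfg B) j y : 𝔸ˣ) : 𝔸) - 1‖ ≤ (64 * (d : ℝ)) * ((L : ℝ) ^ j * b) := by
    obtain ⟨⟨h, -⟩, h64⟩ := eq163_general hL hG hU hα hα3 hα4 h52 hb hB hsmall hc₃ hsm le_rfl y
    exact h.trans h64
  have h := norm_pFac_sub_one_le_explicit L U (expCfg B) j y hL hUl (c := 22 * (d : ℝ)) (c' := 64 * (d : ℝ))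
    (α₁ := (L : ℝ) ^ j * b) (by positivity) (by positivity) hδ hv hx
  refine h.trans (le_of_eq ?_)
  ring_nf

/-- the linearised form: under `4096·d·Lʲb ≤ 1`, `|P(y,x) − 1| ≤ 154d·Lʲb` (`e^{44dt} − 1 ≤ 88dt` for `44dt ≤ 1/64`).
[cite: Balaban1985BackgroundPropagators, (3.57) p.401, (3.58) p.402] -/
theorem norm_pFac_sub_one_le_linear (hL : 2 ≤ L) (hG : AvgClosed d L G) (hU : ∀ x κ, U x κ ∈ G) (hα : 0 < α₀)
    (hα3 : C0 d * α₀ ≤ 1 / 3) (hα4 : 4 * α₀ ≤ c2' d L) (h52 : pdev U < α₀ * (((L : ℝ) ^ j)⁻¹) ^ 2)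
    (hb : 0 ≤ b) (hB : ∀ x κ, ‖B x κ‖ ≤ b)
    (hsmall : Real.exp (4 * (800 * ((d : ℝ) + 1) ^ 2 * ((d : ℝ) + 4)) * α₀)
      * (1 + 8 * (131072 * ((d : ℝ) + 1) ^ 2) * ((L : ℝ) ^ j * b)) ≤ 2)
    (hc₃ : 2 * ((L : ℝ) ^ j * b) ≤ c3 d L) (hsm : 4096 * (d : ℝ) * ((L : ℝ) ^ j * b) ≤ 1)
    (y : Site d) {x : Site d} (hx : (fl L)^[j] x = y) :
    ‖((pFac L U (expCfg B) j y x : 𝔸ˣ) : 𝔸) - 1‖ ≤ 154 * (d : ℝ) * ((L : ℝ) ^ j * b) := by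
  have hsm' : 2048 * (d : ℝ) * ((L : ℝ) ^ j * b) ≤ 1 := by
    have : (0 : ℝ) ≤ (d : ℝ) * ((L : ℝ) ^ j * b) := by positivity
    linarith
  refine (norm_pFac_sub_one_le_general hL hG hU hα hα3 hα4 h52 hb hB hsmall hc₃ hsm' y hx).trans ?_
  set t : ℝ := (d : ℝ) * ((L : ℝ) ^ j * b) with ht
  have ht0 : 0 ≤ t := by positivity
  have ht1 : 4096 * t ≤ 1 := by rw [ht]; linarith
  have hexp : Real.exp (2 * (22 * (d : ℝ)) * ((L : ℝ) ^ j * b)) ≤ 1 + 88 * t := by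
    have heq : 2 * (22 * (d : ℝ)) * ((L : ℝ) ^ j * b) = 44 * t := by rw [ht]; ring
    rw [heq]
    have := exp_sub_one_le_of_le (le_refl (44 * t)) (by positivity) (by linarith)
    linarith
  have h64 : 1 + 64 * (d : ℝ) * ((L : ℝ) ^ j * b) = 1 + 64 * t := by rw [ht]; ring
  have hgoal : 154 * (d : ℝ) * ((L : ℝ) ^ j * b) = 154 * t := by rw [ht]; ring
  rw [h64, hgoal]
  calc (1 + 64 * t) * Real.exp (2 * (22 * (d : ℝ)) * ((L : ℝ) ^ j * b)) - 1 ≤ (1 + 64 * t) * (1 + 88 * t) - 1 := by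
        gcongr
    _ = 152 * t + 5632 * t ^ 2 := by ring
    _ ≤ 154 * t := by nlinarith

/-! ## §2 (3.58)–(3.59) for every `j` -/

/-- **(3.58)–(3.59) FOR EVERY `j`** — *"|F′_{2,j}(A; y, x)| ≤ O(1)α₁, (3.58) hence also |(F′_{2,j}(A)λ)(y)| ≤ O(1)α₁(Q′_j|λ|)(y).
(3.59)"*: under the data of `norm_pFac_sub_one_le_general` and the unit-boundedness of the averages `\overline{U′U}^l`, `l ≤ j`,
of the PRODUCT (file 1's `norm_FpOp_le` compares the rotations by `(U′U)(Γ^{(j)}_{y,x})` and `U(Γ^{(j)}_{y,x})`):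
`|(F′_{2,j}(A)λ)(y)| ≤ 2((1 + 64d·Lʲb)e^{44d·Lʲb} − 1)·(Q′_j|λ|)(y)`. [cite: Balaban1985BackgroundPropagators, (3.58)–(3.59) p.402] -/
theorem norm_FpOp_le_general (hL : 2 ≤ L) (hG : AvgClosed d L G) (hU : ∀ x κ, U x κ ∈ G) (hα : 0 < α₀)
    (hα3 : C0 d * α₀ ≤ 1 / 3) (hα4 : 4 * α₀ ≤ c2' d L) (h52 : pdev U < α₀ * (((L : ℝ) ^ j)⁻¹) ^ 2)
    (hb : 0 ≤ b) (hB : ∀ x κ, ‖B x κ‖ ≤ b)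
    (hsmall : Real.exp (4 * (800 * ((d : ℝ) + 1) ^ 2 * ((d : ℝ) + 4)) * α₀)
      * (1 + 8 * (131072 * ((d : ℝ) + 1) ^ 2) * ((L : ℝ) ^ j * b)) ≤ 2)
    (hc₃ : 2 * ((L : ℝ) ^ j * b) ≤ c3 d L) (hsm : 2048 * (d : ℝ) * ((L : ℝ) ^ j * b) ≤ 1)
    (hU' : ∀ l ≤ j, ∀ x κ, avgIter L (expCfg B * U) l x κ ∈ U1 𝔸) (lam : Site d → 𝔸) (y : Site d) :
    ‖FpOp L U (expCfg B) j lam y‖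
      ≤ 2 * ((1 + 64 * (d : ℝ) * ((L : ℝ) ^ j * b)) * Real.exp (2 * (22 * (d : ℝ)) * ((L : ℝ) ^ j * b)) - 1)
        * QpAbs L j lam y := by
  have hL1 : 1 ≤ L := le_trans (by norm_num) hL
  have hUl : ∀ l ≤ j, ∀ z κ, avgIter L U l z κ ∈ U1 𝔸 := fun l hl =>
    (level_facts hL hG hU hα hα3 hα4 h52 hb hB hsmall hc₃ l hl).1
  exact norm_FpOp_le L hUl hU' lam y fun r =>
    norm_pFac_sub_one_le_general hL hG hU hα hα3 hα4 h52 hb hB hsmall hc₃ hsm y (iterate_fl_bsite L hL1 j y r)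

/-- **(3.58)–(3.59) FOR EVERY `j`, UNITARY PERTURBATIONS** — the extra binder of `norm_FpOp_le_general` DISCHARGED when the product
`U′U` is itself `G`-valued and regular at depth `j` (`pdev (U′U) < α₀′L^{−2j}` with `C₀α₀′ ≤ 1/3`, `4α₀′ ≤ c₂′(d,L)` — for
`𝔤`-valued `A′` as in (3.37), whose derivative condition `|∇^η_UA′| < α₁(Lʲη)⁻²` is what keeps the plaquettes of `U′U` small):
then every `\overline{U′U}^l`, `l ≤ j`, is `G`-valued by [5] Prop. 2 (`B7Prop2Explicit.avgIter_mem`) and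
`|(F′_{2,j}(A)λ)(y)| ≤ 2((1 + 64d·Lʲb)e^{44d·Lʲb} − 1)·(Q′_j|λ|)(y)`. [cite: Balaban1985BackgroundPropagators, (3.58)–(3.59) p.402, (3.37) p.396] -/
theorem norm_FpOp_le_unitary (hL : 2 ≤ L) (hG : AvgClosed d L G) (hU : ∀ x κ, U x κ ∈ G) (hα : 0 < α₀)
    (hα3 : C0 d * α₀ ≤ 1 / 3) (hα4 : 4 * α₀ ≤ c2' d L) (h52 : pdev U < α₀ * (((L : ℝ) ^ j)⁻¹) ^ 2)
    (hb : 0 ≤ b) (hB : ∀ x κ, ‖B x κ‖ ≤ b)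
    (hsmall : Real.exp (4 * (800 * ((d : ℝ) + 1) ^ 2 * ((d : ℝ) + 4)) * α₀)
      * (1 + 8 * (131072 * ((d : ℝ) + 1) ^ 2) * ((L : ℝ) ^ j * b)) ≤ 2)
    (hc₃ : 2 * ((L : ℝ) ^ j * b) ≤ c3 d L) (hsm : 2048 * (d : ℝ) * ((L : ℝ) ^ j * b) ≤ 1)
    (hU'G : ∀ x κ, (expCfg B * U) x κ ∈ G) {α₀' : ℝ} (hα' : 0 < α₀') (hα3' : C0 d * α₀' ≤ 1 / 3)
    (hα4' : 4 * α₀' ≤ c2' d L) (h52' : pdev (expCfg B * U) < α₀' * (((L : ℝ) ^ j)⁻¹) ^ 2)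
    (lam : Site d → 𝔸) (y : Site d) :
    ‖FpOp L U (expCfg B) j lam y‖
      ≤ 2 * ((1 + 64 * (d : ℝ) * ((L : ℝ) ^ j * b)) * Real.exp (2 * (22 * (d : ℝ)) * ((L : ℝ) ^ j * b)) - 1)
        * QpAbs L j lam y := by
  have hα2' : 2 * α₀' ≤ c2' d L := by linarith
  have hU' : ∀ l ≤ j, ∀ x κ, avgIter L (expCfg B * U) l x κ ∈ U1 𝔸 := fun l hl x κ =>
    hG.le_U1 (avgIter_mem L hL hG j (expCfg B * U) hU'G hα' hα3' hα2' h52' l hl x κ)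
  exact norm_FpOp_le_general hL hG hU hα hα3 hα4 h52 hb hB hsmall hc₃ hsm hU' lam y

end Literature.MathematicalPhysics.QuantumFieldTheory.Balaban1983to89.B9Eq358KeyEstimate

end
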